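import Summits.BirchSwinnertonDyer.BirchSwinnertonDyer.Theorems.ThetaPartnerAtTwoSignedControlAtTwoCasselsOfPT
import Summits.BirchSwinnertonDyer.BirchSwinnertonDyer.Theorems.SchneiderFreeAdditiveX3PoitouTateSelmerDualityHolds
import Literature.NumberTheory.EllipticCurves.Greenberg1999.NoProperFiniteIndexSubmoduleH1Sigma
import Literature.NumberTheory.EllipticCurves.Greenberg1999.H1SigmaCorankBound
import Literature.NumberTheory.EllipticCurves.Greenberg1999.LocalQuotientControlSurjective
import Literature.NumberTheory.EllipticCurves.Greenberg1999.H1SigmaInftyRankOne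
import HarnessLib

set_option linter.dupNamespace false -- `…BirchSwinnertonDyer.BirchSwinnertonDyer…` is the cell's nested layout (D-0017)
set_option autoImplicit false

/-!
# Cassels' surjectivity for `H¹_Σ` (Greenberg LNM 1716 Prop. 4.13 / p. 122) HOLDS over every number field, and the
# Greenberg pack `PublishedInputsGreenbergControlAtTwo` (item 24143) from FOUR of its five conjuncts
# (LADDER-BSD D-0154 (2), INPUTS-LIST-1 v2 DELTA-4 §2(d): "when PT1 lands")

Seat `bsd-inputs-honda-p1` (gen 6, idle INPUTS prover of the desk `pub/bsd-wall/bsd-inputs`), `--supports`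
stmt-BirchSwinnertonDyer-24143. THEOREMS ONLY (no definition, no named fact, no `sorry`); ROUTE-FREE: this module's import closure
contains no `Theses/*.lean`, so the route files `Theses/ThetaPartnerAtTwo.lean` / `Theses/ResidualThetaTransportAtTwo.lean` (whose
`closes` bind `hPubG : PublishedInputsGreenbergControlAtTwo`) may import it without a cycle, as may any `Theorems` file.

## What this file records

Two tree theorems landed on 2026-08-28 combine:

* `SignedEC.CasselsPT.casselsSurjectivity_H1Sigma_of_poitouTate (hPT : poitouTate_selmerStructure_duality K) :
  Greenberg1999.casselsSurjectivity_H1Sigma K` (bsd-wall K4, module `Theorems.ThetaPartnerAtTwoSignedControlAtTwoCasselsOfPT`,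
  p613266: Cassels' theorem FROM Poitou–Tate, every number field `K : Type`), and
* `SchneiderFreeAdditiveX3.PoitouTateReduction.poitouTate_selmerStructure_duality_holds (K) : poitouTate_selmerStructure_duality K`
  (bsd-schneider door-c4 g18, module `Theorems.SchneiderFreeAdditiveX3PoitouTateSelmerDualityHolds`, p624636: PT1 for every `K`),

into the HYPOTHESIS-FREE named fact `Greenberg1999.casselsSurjectivity_H1Sigma K` (§1, `casselsSurjectivity_H1Sigma_holds`).
Hence conjunct 1 (`casselsSurjectivity_H1Sigma ℚ`) of the five-conjunct pack item 24143 `PublishedInputsGreenbergControlAtTwo`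
(routes `ThetaPartnerAtTwo` / `ResidualThetaTransportAtTwo`; binder `hPubG` of both `closes`) is a theorem, and the pack follows
from its other FOUR conjuncts — Greenberg Prop. 4.12 (no finite `Λ`-submodule in `Λ`-rank one), the corank bound
`corank_{ℤ_p} H¹(ℚ_Σ/ℚ, E[p^∞]) ≤ 1`, the surjectivity of restriction on local quotients, weak Leopoldt in rank one (§5 p. 140 /
Kato Thm. 12.4) — `publishedInputsGreenbergControlAtTwo_of_four` (§2, item signature VERBATIM; the route decls are `def … : Prop :=`
aliases of it and apply by `exact`). Nothing is re-derived; no landed declaration is restated.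

## Honest framing

§1 is an UNCONDITIONAL theorem (Cassels 1964 / Greenberg 1999 Prop. 4.13 with `E(K)[p^∞]^{Γ_K} = 0`, via classical Poitou–Tate
duality — both kernel-checked elsewhere in the tree and only composed here). §2 is CONDITIONAL (four named Greenberg facts as
hypotheses; none of them is formalised) and closes nothing: 24143 is a permanently-held published-input pack (displayed inputs
5 → 4 once a pen re-keys). No crux and no summit statement is proved; the Birch–Swinnerton-Dyer conjecture is NOT proved by any
of this.

References: [GreenbergLNM1716] §4 Appendix Prop. 4.13 and p. 122, Prop. 4.12 p. 119, pp. 108, 119–120, §5 p. 140;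
[Cassels1964ArithmeticVII] Thm.; [MilneADT2006] I Thm. 4.10, Thm. 6.13; [Kato2004Asterisque] Thm. 12.4.
-/

namespace Summit.BirchSwinnertonDyer.BirchSwinnertonDyer.Theorems.InputsPoitouTateSelmer

open Literature.NumberTheory.GaloisCohomology Literature.NumberTheory.EllipticCurves
  Literature.NumberTheory.EllipticCurves.Greenberg1999

/-! ## §1 Cassels' surjectivity for `H¹_Σ` over every number field, hypothesis-free -/

section Cassels

/-! The one parameter of the named fact (the number field); the discharge below is the closed statement at every `K`. -/
variable (K : Type) [Field K] [NumberField K]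

/-- **Greenberg 1999 Prop. 4.13 / p. 122 (Cassels' theorem), the named fact `Greenberg1999.casselsSurjectivity_H1Sigma K` —
PROVED for every number field `K : Type`:** if `Sel_{p^∞}(E/K)` is finite and `E(K̄)[p^∞]^{Γ_K} = 0`, every family of
`p`-power-torsion local classes on `Σ = S₀ ∪ {v ∣ p} ∪ ∞` (good reduction off `S₀ ∪ {v ∣ p}`) is the family of localisations of
ONE class of `H¹(K_Σ/K, E[p^∞])`. Composition of the K4 theorem `SignedEC.CasselsPT.casselsSurjectivity_H1Sigma_of_poitouTate`
(Cassels from Poitou–Tate) with the bsd-schneider theorem `SchneiderFreeAdditiveX3.PoitouTateReduction.poitouTate_selmerStructure_duality_holds`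
(Poitou–Tate duality for Selmer structures, every `K`). Unconditional; BSD is not proved by this.
[cite: GreenbergLNM1716, §4 Appendix Prop. 4.13 and p. 122] [cite: Cassels1964ArithmeticVII, Thm. (the dual exact sequence)]
[cite: MilneADT2006, I Thm. 4.10 (b) and Thm. 6.13] -/
theorem casselsSurjectivity_H1Sigma_holds : casselsSurjectivity_H1Sigma K :=
  SignedEC.CasselsPT.casselsSurjectivity_H1Sigma_of_poitouTate
    (SchneiderFreeAdditiveX3.PoitouTateReduction.poitouTate_selmerStructure_duality_holds K)

end Cassels

/-! ## §2 Item 24143 `PublishedInputsGreenbergControlAtTwo` from four of its five conjuncts -/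

/-- **Item 24143 `PublishedInputsGreenbergControlAtTwo` (signature VERBATIM) from FOUR displayed inputs**: Greenberg Prop. 4.12
(`h412`), the `ℤ_p`-corank bound over `ℚ` (`hcorank`), the local-quotient restriction surjectivity over `ℚ` (`hloc`) and weak
Leopoldt in rank one (`hrank1`) — binders in the pack's order with conjunct 1 dropped, conjunct 1 being
`casselsSurjectivity_H1Sigma_holds ℚ` (§1). The certified collapse term for the pens of `ThetaPartnerAtTwo` /
`ResidualThetaTransportAtTwo` (binder `hPubG`; displayed print inputs 5 → 4). Conditional; closes nothing; BSD is not proved by this.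
[cite: GreenbergLNM1716, Prop. 4.12 p. 119, pp. 108 and 119–120, §5 p. 140, §4 Appendix Prop. 4.13]
[cite: Kato2004Asterisque, Thm. 12.4 (1)(2) p. 221] -/
theorem publishedInputsGreenbergControlAtTwo_of_four
    (h412 : prop412_noFiniteSubmodule_H1Sigma_of_rank_one) (hcorank : h1Sigma_zpCorank_le_degree ℚ)
    (hloc : localQuotient_restriction_surjective ℚ) (hrank1 : h1SigmaInfty_rank_eq_one) :
    casselsSurjectivity_H1Sigma ℚ ∧ prop412_noFiniteSubmodule_H1Sigma_of_rank_one ∧ h1Sigma_zpCorank_le_degree ℚ ∧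
      localQuotient_restriction_surjective ℚ ∧ h1SigmaInfty_rank_eq_one :=
  ⟨casselsSurjectivity_H1Sigma_holds ℚ, h412, hcorank, hloc, hrank1⟩

end Summit.BirchSwinnertonDyer.BirchSwinnertonDyer.Theorems.InputsPoitouTateSelmer
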